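import Summits.AnomalousDissipation.AnomalousDissipation.Theses.LoudWindows

/-!
# Glue of the split of `LoudWindows.PowerRealisesDissipation` (stmt-AnomalousDissipation-24060)

Sorry-free proof of the GLUE item `LoudWindows.PowerRealisesDissipationGlue` (stmt-AnomalousDissipation-26824):
`MeanNoDefect → TimeAverageLaw → LawRealisation → PowerRealisesDissipation`.  At each `j`: `TimeAverageLaw` turns the bounded
power-floored Leray–Hopf trajectory into a stationary Leray–Hopf law (cap `E`, power `ε`); `MeanNoDefect` gives that law the
ν-uniform dissipation floor `δ(f,E,ε)`; `LawRealisation` realises a path of the law with mean energy `≤ C` and mean dissipation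
`≥ δ'`; the realised paths are global Leray–Hopf solutions from their own data (`IsStationaryLerayHopfLaw.isGlobalLerayHopf`), so
`choose` assembles the zeroth-law family for the SAME force.  No facts are asserted.
Source: decomp-ad cell, lens-3 g3 split of LoudWindows:24060 (kernel `run/shared/lean/pub/decomp-ad/decomp-ad-lens-3/split_g3/split_check.lean`,
theorem `powerRealisesDissipation_of_children`; also `ErgodicDictionary.powerRealisesDissipation_of`); landed by the cell's prover seat.
-/

set_option linter.dupNamespace false

open Filter Topology MeasureTheory

namespace Summit.AnomalousDissipation.AnomalousDissipation.Theorems.PowerRealisesDissipationGlue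

open Summit.AnomalousDissipation.AnomalousDissipation.Theses.LoudWindows

/-- The GLUE item `LoudWindows.PowerRealisesDissipationGlue` (stmt-AnomalousDissipation-26824) holds. [folklore] -/
theorem powerRealisesDissipationGlue_holds : PowerRealisesDissipationGlue := by
  intro hE hT hR hA
  obtain ⟨f, hfs, hfd, hfm, ν, u₀, u, hν, hν0, hLH, ⟨E, hEn⟩, ε, hε, hP⟩ := hA
  obtain ⟨δ, hδ, hEν⟩ := hE f hfs hfd hfm E ε hε
  obtain ⟨C, δ', hδ', hRν⟩ := hR f hfs hfd hfm E δ hδ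
  have key : ∀ j, ∃ (v₀ : UnitAddTorus (Fin 3) → EuclideanSpace ℝ (Fin 3))
      (v : ℝ → UnitAddTorus (Fin 3) → EuclideanSpace ℝ (Fin 3)),
      Literature.Analysis.FluidPDE.Torus.IsGlobalLerayHopf (ν j) (fun _ => f) v₀ v ∧
        Literature.Analysis.FluidPDE.meanEnergy v ≤ C ∧
        δ' ≤ Literature.Analysis.FluidPDE.meanDissipation (ν j) v := by
    intro j
    obtain ⟨Ω, mΩ, P, S, traj, hlaw, hcap, hpow⟩ :=
      hT (ν j) (hν j) f hfs hfd hfm E ε (u₀ j) (u j) (hLH j) (hEn j) (hP j)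
    have hdis := hEν (ν j) (hν j) Ω P S traj hlaw hcap hpow
    obtain ⟨ω, hωE, hωD⟩ := hRν (ν j) (hν j) Ω P S traj hlaw hcap hdis
    exact ⟨traj ω 0, traj ω, hlaw.isGlobalLerayHopf ω, hωE, hωD⟩
  choose v₀ v hv using key
  unfold _root_.AnomalousDissipation Literature.Turb.ZerothLaw
  exact ⟨f, hfs, hfd, hfm, ν, v₀, v, hν, hν0, fun j => (hv j).1, ⟨C, fun j => (hv j).2.1⟩, δ', hδ',
    fun j => (hv j).2.2⟩

end Summit.AnomalousDissipation.AnomalousDissipation.Theorems.PowerRealisesDissipationGlue
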